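import Literature.NumberTheory.Automorphic.ResiduallyUnipotentFixedCosetCount     -- ★-to-be (this seat): R1 `isNilpotent_redMat_conj_sub_one_of_charpoly`, §3 unitary lattice counts, §4 `ncard_fixedBy_sep_congr`
import Literature.NumberTheory.Automorphic.OrbitalIntegralFixedPointStrata         -- ★-to-be (this seat): `classOrbitalIntegral_eq_smul_sum_ncard_strata`
import Literature.NumberTheory.Automorphic.UnitaryUnitOrbitalIntegralFixedPoints   -- ★ `isRegularElt_val_conj`, ★ `isClosed_conjClass_local_of_isRegularElt`, instances on `(cmDatum L N H).Local v`
import Literature.NumberTheory.Rogawski1990.LocalTransferFundamentalLemma          -- ★ `IsLocSmooth`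
import Literature.LinearAlgebra.Matrix.AdjugateOfNilpotent                         -- ★ `pow_card_eq_zero_of_isNilpotent`
import HarnessLib

/-!
# The orbital integral of a DEPTH-ZERO PIECE at a deep class of `U(H)(L⁺_v)`: `Φ(⟦t⟧, g) = ν(K_v) · (c₀ n₀(t) + c₁ n₁(t) + c₂ n₂(t))`,
# the strata counted on the one-place model `U(σ_w, H_w)(L_w)` and `n₂` as the number of `t`-stable lattices free of rank one over `𝒪_w[t]`

Topic `NumberTheory/Automorphic`; namespace `Literature.NumberTheory.Automorphic`.  THEOREMS ONLY (no definition, no instance, no notation, no named fact,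
no `sorry`).  Cell `pub/hodgecm-mathlib` (D-0151), crux H413 = `stmt-HodgeConjecture-24833`; road «S3-tree» (LEAD F0P3a-plan (g11), architect A-p16 (g29) A-65 (1)),
brick T3′ «depth-zero κ-transfer» (holder F0P3b-p01 (g11), HEAD v2 9fec650d, DESIGN v1 419b4e54 §2 O8), organ **O8b «THE FOUR VALUES OF g»** (A-p12 (g21)), FILE 3∕3:
the CM-place instantiation of ★ `classOrbitalIntegral_eq_smul_sum_ncard_strata` in the tokens of HEAD v2 (`G′_v = (cmDatum L 3 H′).Local v`, `K = cmLocalIntegralLevel`,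
the `w`-component reduction `redMat (k_w)`), with the stratum counts moved to the one-place matrix model and `n₂` landed on a lattice set.  HONEST LABEL: HC_CM is proved
only modulo the 2 remaining named inputs (hLiu418 24832, h413 24833) until rung 0 closes; nothing printed is asserted here.

THE MATHEMATICS.  (§1, `GL_n` over a valued field) conjugating by `k ∈ GL_n(𝒪)` conjugates the reduction by `k̄ ∈ GL_n(𝓀)`: the Jordan rank `rank(x̄ − 1)` and the
nilpotency `(x̄ − 1)^m = 0` of an integral `x` are `GL_n(𝒪)`-conjugation invariants (so the strata `ψ_r` are `Ad K`-invariant and the counts are representative-free).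
(§2, the CM place) at a non-split place `v` of `L⁺` (`w ∣ v`, `c • w = w`), for `t ∈ U(H)(L⁺_v)` DEEP at `w` (`p_{t_w} ≡ (X − 1)^N` coefficientwise mod `𝔪_w`) every conjugate
`x⁻¹ t x ∈ K_v = U(H)(𝒪_v)` is residually unipotent at `w` (★ R1 through ★ `localNonsplitEquiv` ∕ ★ `mem_localIntegralLevel_iff_of_smul_eq`); hence for a depth-zero piece
`g` (★ `IsLocSmooth`, `tsupport g ⊆ K_v`, `Ad K_v`-invariant, `g k = c (rank(k̄_w − 1))` on the residually-unipotent part of `K_v` — HEAD v2's `hc`) and `t` regular with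
compact centraliser: **`classOrbitalIntegral mG g ⟦t⟧ = νG(K_v) · Σ_{r<N} n_r(t) • c r`**, `n_r(t) = #{q ∈ Fix_t(G′_v ⧸ K_v) : rank(red((q.out⁻¹ t q.out)_w) − 1) = r}`;
(§3) each `n_r(t)` equals the same count on the one-place model `U(σ_w, H_w)(L_w) ⧸ (U ∩ GL_N(𝒪_w))` at `t_w` (★ §4 transport), and `n_{N−1}(t)` is the number of
`t_w`-stable lattices `Λ(u)`, `u ∈ U(σ_w, H_w)(L_w)`, of the form `⊕_{j<N} 𝒪_w·t_w^j w` (★ `ncard_fixedBy_unitary_rank_eq_ncard_free`) — O8a's input set.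

* §0 `mulVecLin_pow_apply`, `rank_lt_of_isNilpotent`, `real_smul_sum_range_three_nsmul`.
* §1 `redMat_coe_mul_of_mem_glInt`, `redMat_coe_inv_mul_redMat_coe`, `redMat_conj_sub_one_eq`, **`rank_redMat_conj_sub_one_eq`**, **`redMat_conj_sub_one_pow_eq_zero_iff`**.
* §2 `redMat_sub_one_pow_eq_zero_of_deep`.
* §3 **`ncard_fixedBy_rankStratum_eq_ncard_localNonsplitEquiv`**, **`ncard_fixedBy_rankStratum_eq_ncard_free_of_deep`**.
* §4 **`classOrbitalIntegral_eq_smul_sum_ncard_rankStrata_of_deep`** (any `N`, any Banach `E`), **`classOrbitalIntegral_eq_mul_strata_three_of_deep`** (`N = 3`, `ℂ`: the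
  O8d-1s socket shape `ν(K_v)·(c₀n₀ + c₁n₁ + c₂n₂)`).

## References
* [Rogawski1990] J. D. Rogawski, *Automorphic Representations of Unitary Groups in Three Variables* (1990): §4.9 p. 54, Prop. 4.9.1 p. 55.
* [Kottwitz1986] R. E. Kottwitz, *Base change for unit elements of Hecke algebras*, Compositio Math. 60 (1986): §3.
* [Laumon1995] G. Laumon, *Cohomology of Drinfeld Modular Varieties* I (1996): Lemma (5.3.2) p. 136.
* [PlatonovRapinchuk1994] V. Platonov, A. Rapinchuk, *Algebraic Groups and Number Theory* (1994): §5.1 (one-place models at non-split places).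
-/

set_option autoImplicit false

noncomputable section

open scoped ValuativeRel Matrix MatrixGroups Polynomial
open ValuativeRel Set MeasureTheory Measure Topology NumberField IsDedekindDomain
open Literature.NumberTheory.Rogawski1990

namespace Literature.NumberTheory.Automorphic

open Literature.NumberTheory.Automorphic.IntegralReduction Literature.NumberTheory.Automorphic.UnitaryGroup

/-! ## §0 A nilpotent matrix over a field has rank `< N` -/

section Field

variable {𝕜 : Type*} [Field 𝕜] {N : ℕ}

/-- `(M^k)` acts by the `k`-th iterate of `M`. [cite: Kottwitz1986, §3] -/
theorem mulVecLin_pow_apply (M : Matrix (Fin N) (Fin N) 𝕜) (k : ℕ) (v : Fin N → 𝕜) : (M ^ k).mulVecLin v = (M.mulVecLin)^[k] v := by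
  induction k generalizing v with
  | zero => rw [pow_zero, Function.iterate_zero, id, Matrix.mulVecLin_apply, Matrix.one_mulVec]
  | succ k ih => rw [pow_succ, Matrix.mulVecLin_mul, LinearMap.comp_apply, ih, Function.iterate_succ, Function.comp_apply]

/-- **A NILPOTENT `N × N` MATRIX OVER A FIELD HAS RANK `< N`** (`N ≥ 1`): full rank would make `M`, hence `M^k = 0`, surjective.
[cite: HornJohnson2013, §3.2 Problem 3.2.P27 (b) p. 190] -/
theorem rank_lt_of_isNilpotent {M : Matrix (Fin N) (Fin N) 𝕜} (hM : IsNilpotent M) (hN : 0 < N) : M.rank < N := by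
  by_contra h
  have hrk : M.rank = N := le_antisymm (Matrix.rank_le_width M) (not_lt.1 h)
  have htop : LinearMap.range M.mulVecLin = ⊤ := by
    apply Submodule.eq_top_of_finrank_eq
    rw [Module.finrank_fin_fun]
    exact hrk
  have hsurj : Function.Surjective M.mulVecLin := LinearMap.range_eq_top.1 htop
  obtain ⟨k, hk⟩ := hM
  have hsurjk : Function.Surjective (M ^ k).mulVecLin := by
    intro v
    obtain ⟨u, hu⟩ := hsurj.iterate k v
    exact ⟨u, by rw [mulVecLin_pow_apply, hu]⟩
  obtain ⟨u, hu⟩ := hsurjk (Pi.single ⟨0, hN⟩ 1)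
  rw [hk, Matrix.mulVecLin_apply, Matrix.zero_mulVec] at hu
  have h1 := congr_fun hu ⟨0, hN⟩
  rw [Pi.zero_apply, Pi.single_eq_same] at h1
  exact zero_ne_one h1

/-- Bookkeeping for the `N = 3` socket: `a • Σ_{r<3} n_r • c_r = a·(c₀n₀ + c₁n₁ + c₂n₂)` in `ℂ`. [cite: Rogawski1990, §4.9 p. 54] -/
theorem real_smul_sum_range_three_nsmul (a : ℝ) (m : ℕ → ℕ) (c : ℕ → ℂ) :
    a • ∑ r ∈ Finset.range 3, m r • c r = (a : ℂ) * (c 0 * (m 0 : ℂ) + c 1 * (m 1 : ℂ) + c 2 * (m 2 : ℂ)) := by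
  rw [Finset.sum_range_succ, Finset.sum_range_succ, Finset.sum_range_succ, Finset.sum_range_zero, zero_add, nsmul_eq_mul, nsmul_eq_mul, nsmul_eq_mul,
    Complex.real_smul]
  ring

end Field

/-! ## §1 The Jordan rank and the nilpotency of the reduction are `GL_n(𝒪)`-conjugation invariants -/

section Reduction

variable {F : Type*} [Field F] [ValuativeRel F] {n : ℕ}

/-- `red(x y) = red x · red y` for `x, y ∈ GL_n(𝒪)`. [cite: Kottwitz1986, §3] -/
theorem redMat_coe_mul_of_mem_glInt {x y : GL (Fin n) F} (hx : x ∈ glInt n F) (hy : y ∈ glInt n F) :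
    redMat ((x * y : GL (Fin n) F) : Matrix (Fin n) (Fin n) F) = redMat (x : Matrix (Fin n) (Fin n) F) * redMat (y : Matrix (Fin n) (Fin n) F) := by
  rw [Units.val_mul]
  exact redMat_mul (fun i j => (Valuation.mem_integer_iff _ _).1 (((mem_glInt_iff _).1 hx).1 i j))
    (fun i j => (Valuation.mem_integer_iff _ _).1 (((mem_glInt_iff _).1 hy).1 i j))

/-- `red(k⁻¹) · red(k) = 1` for `k ∈ GL_n(𝒪)`. [cite: Kottwitz1986, §3] -/
theorem redMat_coe_inv_mul_redMat_coe {k : GL (Fin n) F} (hk : k ∈ glInt n F) :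
    redMat (((k⁻¹ : GL (Fin n) F)) : Matrix (Fin n) (Fin n) F) * redMat (k : Matrix (Fin n) (Fin n) F) = 1 := by
  rw [← redMat_coe_mul_of_mem_glInt (inv_mem hk) hk, inv_mul_cancel, Units.val_one, redMat_one]

/-- `red(k) · red(k⁻¹) = 1` for `k ∈ GL_n(𝒪)`. [cite: Kottwitz1986, §3] -/
theorem redMat_coe_mul_redMat_coe_inv {k : GL (Fin n) F} (hk : k ∈ glInt n F) :
    redMat (k : Matrix (Fin n) (Fin n) F) * redMat (((k⁻¹ : GL (Fin n) F)) : Matrix (Fin n) (Fin n) F) = 1 := by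
  rw [← redMat_coe_mul_of_mem_glInt hk (inv_mem hk), mul_inv_cancel, Units.val_one, redMat_one]

/-- **`red(k⁻¹ x k) − 1 = red(k⁻¹) · (red x − 1) · red k`** for `k, x ∈ GL_n(𝒪)`. [cite: Kottwitz1986, §3] -/
theorem redMat_conj_sub_one_eq {k x : GL (Fin n) F} (hk : k ∈ glInt n F) (hx : x ∈ glInt n F) :
    redMat (((k⁻¹ * x * k : GL (Fin n) F)) : Matrix (Fin n) (Fin n) F) - 1 =
      redMat (((k⁻¹ : GL (Fin n) F)) : Matrix (Fin n) (Fin n) F) * (redMat (x : Matrix (Fin n) (Fin n) F) - 1) * redMat (k : Matrix (Fin n) (Fin n) F) := by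
  rw [redMat_coe_mul_of_mem_glInt (mul_mem (inv_mem hk) hx) hk, redMat_coe_mul_of_mem_glInt (inv_mem hk) hx, Matrix.mul_sub, Matrix.sub_mul, Matrix.mul_one,
    redMat_coe_inv_mul_redMat_coe hk]

/-- **THE JORDAN RANK IS A `GL_n(𝒪)`-CONJUGATION INVARIANT**: `rank(red(k⁻¹xk) − 1) = rank(red x − 1)`. [cite: Kottwitz1986, §3] [cite: Rogawski1990, §4.9 p. 54] -/
theorem rank_redMat_conj_sub_one_eq {k x : GL (Fin n) F} (hk : k ∈ glInt n F) (hx : x ∈ glInt n F) :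
    (redMat (((k⁻¹ * x * k : GL (Fin n) F)) : Matrix (Fin n) (Fin n) F) - 1).rank = (redMat (x : Matrix (Fin n) (Fin n) F) - 1).rank := by
  have hdet : IsUnit (redMat (k : Matrix (Fin n) (Fin n) F)).det :=
    IsUnit.of_mul_eq_one (redMat (((k⁻¹ : GL (Fin n) F)) : Matrix (Fin n) (Fin n) F)).det (by rw [← Matrix.det_mul, redMat_coe_mul_redMat_coe_inv hk, Matrix.det_one])
  have hdet' : IsUnit (redMat (((k⁻¹ : GL (Fin n) F)) : Matrix (Fin n) (Fin n) F)).det :=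
    IsUnit.of_mul_eq_one (redMat (k : Matrix (Fin n) (Fin n) F)).det (by rw [← Matrix.det_mul, redMat_coe_inv_mul_redMat_coe hk, Matrix.det_one])
  rw [redMat_conj_sub_one_eq hk hx, Matrix.rank_mul_eq_left_of_isUnit_det _ _ hdet, Matrix.rank_mul_eq_right_of_isUnit_det _ _ hdet']

/-- **THE NILPOTENCY OF THE REDUCTION IS A `GL_n(𝒪)`-CONJUGATION INVARIANT**: `(red(k⁻¹xk) − 1)^m = 0 ↔ (red x − 1)^m = 0`. [cite: Kottwitz1986, §3] -/
theorem redMat_conj_sub_one_pow_eq_zero_iff {k x : GL (Fin n) F} (hk : k ∈ glInt n F) (hx : x ∈ glInt n F) (m : ℕ) :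
    (redMat (((k⁻¹ * x * k : GL (Fin n) F)) : Matrix (Fin n) (Fin n) F) - 1) ^ m = 0 ↔ (redMat (x : Matrix (Fin n) (Fin n) F) - 1) ^ m = 0 := by
  -- `(A⁻¹ M A)^m = A⁻¹ M^m A` for the unit `A = red k`
  have hpow : ∀ m : ℕ, (redMat (((k⁻¹ * x * k : GL (Fin n) F)) : Matrix (Fin n) (Fin n) F) - 1) ^ m =
      redMat (((k⁻¹ : GL (Fin n) F)) : Matrix (Fin n) (Fin n) F) * (redMat (x : Matrix (Fin n) (Fin n) F) - 1) ^ m * redMat (k : Matrix (Fin n) (Fin n) F) := by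
    intro m
    induction m with
    | zero => rw [pow_zero, pow_zero, Matrix.mul_one, redMat_coe_inv_mul_redMat_coe hk]
    | succ m ih =>
      rw [pow_succ, ih, redMat_conj_sub_one_eq hk hx,
        show redMat (((k⁻¹ : GL (Fin n) F)) : Matrix (Fin n) (Fin n) F) * (redMat (x : Matrix (Fin n) (Fin n) F) - 1) ^ m * redMat (k : Matrix (Fin n) (Fin n) F) *
            (redMat (((k⁻¹ : GL (Fin n) F)) : Matrix (Fin n) (Fin n) F) * (redMat (x : Matrix (Fin n) (Fin n) F) - 1) * redMat (k : Matrix (Fin n) (Fin n) F)) =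
          redMat (((k⁻¹ : GL (Fin n) F)) : Matrix (Fin n) (Fin n) F) * (redMat (x : Matrix (Fin n) (Fin n) F) - 1) ^ m *
            (redMat (k : Matrix (Fin n) (Fin n) F) * redMat (((k⁻¹ : GL (Fin n) F)) : Matrix (Fin n) (Fin n) F)) * (redMat (x : Matrix (Fin n) (Fin n) F) - 1) *
              redMat (k : Matrix (Fin n) (Fin n) F) by simp only [Matrix.mul_assoc],
        redMat_coe_mul_redMat_coe_inv hk, Matrix.mul_one, pow_succ, Matrix.mul_assoc _ ((redMat (x : Matrix (Fin n) (Fin n) F) - 1) ^ m) (redMat (x : Matrix (Fin n) (Fin n) F) - 1)]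
  rw [hpow]
  constructor
  · intro h
    have h' := congrArg (fun M => redMat (k : Matrix (Fin n) (Fin n) F) * M * redMat (((k⁻¹ : GL (Fin n) F)) : Matrix (Fin n) (Fin n) F)) h
    simp only [Matrix.mul_zero, Matrix.zero_mul] at h'
    rw [← h', ← Matrix.mul_assoc, ← Matrix.mul_assoc, redMat_coe_mul_redMat_coe_inv hk, Matrix.one_mul, Matrix.mul_assoc, redMat_coe_mul_redMat_coe_inv hk,
      Matrix.mul_one]
  · intro h
    rw [h, Matrix.mul_zero, Matrix.zero_mul]

/-- The Jordan-rank label read inside a subgroup `U ≤ GL_n(F)`: for `k, y ∈ U ∩ GL_n(𝒪)`, `rank(red(k⁻¹yk) − 1) = r ↔ rank(red y − 1) = r`. [cite: Kottwitz1986, §3] -/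
theorem rank_redMat_coe_conj_sub_one_eq_iff (U : Subgroup (GL (Fin n) F)) {k y : ↥U} (hk : (k : GL (Fin n) F) ∈ glInt n F)
    (hy : (y : GL (Fin n) F) ∈ glInt n F) (r : ℕ) :
    (redMat ((((k⁻¹ * y * k : ↥U)) : GL (Fin n) F) : Matrix (Fin n) (Fin n) F) - 1).rank = r ↔
      (redMat (((y : GL (Fin n) F)) : Matrix (Fin n) (Fin n) F) - 1).rank = r := by
  rw [Subgroup.coe_mul, Subgroup.coe_mul, Subgroup.coe_inv, rank_redMat_conj_sub_one_eq hk hy]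

end Reduction

/-! ## §2 The CM place: the orbital integral of a depth-zero piece at a deep class -/

section CM

variable (L : Type) [Field L] [NumberField L] [IsCMField L] (N : ℕ) (H : Matrix (Fin N) (Fin N) L) (v : HeightOneSpectrum (𝓞 ↥(maximalRealSubfield L)))
  (w : UnitaryGroup.PlacesOver L v) (hw : IsCMField.complexConj L • w.1 = w.1)

include hw in
/-- **DEEP AT `w` ⇒ RESIDUALLY UNIPOTENT ON EVERY FIXED COSET** (CM place form of ★ `isNilpotent_redMat_conj_sub_one_of_charpoly`): if the `w`-component `t_w` of
`t ∈ U(H)(L⁺_v)` has `p_{t_w} ≡ (X − 1)^N (mod 𝔪_w)` coefficientwise, then every conjugate `x⁻¹ t x ∈ U(H)(𝒪_v)` has `(red((x⁻¹tx)_w) − 1)^N = 0`.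
[cite: Kottwitz1986, §3] [cite: PlatonovRapinchuk1994, §5.1] -/
theorem redMat_sub_one_pow_eq_zero_of_deep (t : (cmDatum L N H).Local v)
    (ht : ∀ m : ℕ, valuation (w.1.adicCompletion L)
      (((((t.val : GL (Fin N) (LocalRing L v)).val.map (Pi.evalRingHom (fun w' : UnitaryGroup.PlacesOver L v => w'.1.adicCompletion L) w))).charpoly -
        (Polynomial.X - 1) ^ N).coeff m) < 1)
    (x : (cmDatum L N H).Local v) (hx : x⁻¹ * t * x ∈ cmLocalIntegralLevel L N H v) :
    (redMat (((x⁻¹ * t * x : (cmDatum L N H).Local v).val : GL (Fin N) (LocalRing L v)).val.map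
        (Pi.evalRingHom (fun w' : UnitaryGroup.PlacesOver L v => w'.1.adicCompletion L) w)) - 1) ^ N = 0 := by
  -- the `w`-component as a monoid hom `π : GL_N(∏_{w′ ∣ v} L_{w′}) →* GL_N(L_w)`
  let φ : LocalRing L v →+* w.1.adicCompletion L := Pi.evalRingHom (fun w' : UnitaryGroup.PlacesOver L v => w'.1.adicCompletion L) w
  let π : GL (Fin N) (LocalRing L v) →* GL (Fin N) (w.1.adicCompletion L) :=
    Units.map (φ.mapMatrix : Matrix (Fin N) (Fin N) (LocalRing L v) →+* Matrix (Fin N) (Fin N) (w.1.adicCompletion L)).toMonoidHom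
  -- `(x⁻¹ t x)_w = x_w⁻¹ t_w x_w ∈ GL_N(𝒪_w)` (★ `mem_localIntegralLevel_iff_of_smul_eq`; the one-place model is `π` on matrices)
  have hk : (π x.val)⁻¹ * π t.val * π x.val ∈ glInt N (w.1.adicCompletion L) := by
    have h := (mem_localIntegralLevel_iff_of_smul_eq (IsCMField.complexConj L) N H (IsCMField.complexConj_ne_one L) w hw (x⁻¹ * t * x)).1 hx
    have hval : ((localNonsplitEquiv (IsCMField.complexConj L) H (IsCMField.complexConj_ne_one L) w hw (x⁻¹ * t * x) :
        ↥(unitaryGroupOfForm (galAdicCompletionMap (L := L) (IsCMField.complexConj L) hw) (placeForm H w.1))) : GL (Fin N) (w.1.adicCompletion L)) =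
        (π x.val)⁻¹ * π t.val * π x.val := by
      rw [← map_inv, ← map_mul, ← map_mul]
      exact Units.ext rfl
    rw [hval] at h
    exact h
  have hnil := isNilpotent_redMat_conj_sub_one_of_charpoly (π t.val) (π x.val) hk ht
  have h := Literature.LinearAlgebra.Matrix.AdjugateOfNilpotent.pow_card_eq_zero_of_isNilpotent hnil
  rw [Fintype.card_fin] at h
  have hval2 : ((((π x.val)⁻¹ * π t.val * π x.val : GL (Fin N) (w.1.adicCompletion L))) : Matrix (Fin N) (Fin N) (w.1.adicCompletion L)) =
      ((x⁻¹ * t * x : (cmDatum L N H).Local v).val : GL (Fin N) (LocalRing L v)).val.map φ := by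
    rw [← map_inv, ← map_mul, ← map_mul]
    rfl
  rw [hval2] at h
  exact h

/-! ## §3 The stratum counts on the one-place model `U(σ_w, H_w)(L_w)`, and `n_{N−1}` as a lattice count -/

include hw in
/-- **EACH STRATUM COUNT MOVES TO THE ONE-PLACE MODEL**: `#{q ∈ Fix_t(U(H)(L⁺_v) ⧸ U(H)(𝒪_v)) : rank(red((q.out⁻¹ t q.out)_w) − 1) = r} =
#{q′ ∈ Fix_{t_w}(U(σ_w, H_w)(L_w) ⧸ (U ∩ GL_N(𝒪_w))) : rank(red(q′.out⁻¹ t_w q′.out) − 1) = r}` (★ `ncard_fixedBy_sep_congr` along ★ `localNonsplitEquiv`,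
levels matched by ★ `mem_localIntegralLevel_iff_of_smul_eq`, the rank label `GL_N(𝒪_w)`-conjugation invariant by §1). [cite: Kottwitz1986, §3] [cite: PlatonovRapinchuk1994, §5.1] -/
theorem ncard_fixedBy_rankStratum_eq_ncard_localNonsplitEquiv (t : (cmDatum L N H).Local v) (r : ℕ) :
    {q : (cmDatum L N H).Local v ⧸ cmLocalIntegralLevel L N H v |
        q ∈ MulAction.fixedBy ((cmDatum L N H).Local v ⧸ cmLocalIntegralLevel L N H v) t ∧
          (redMat ((((q.out⁻¹ * t * q.out : (cmDatum L N H).Local v)).val : GL (Fin N) (LocalRing L v)).val.map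
            (Pi.evalRingHom (fun w' : UnitaryGroup.PlacesOver L v => w'.1.adicCompletion L) w)) - 1).rank = r}.ncard =
      {q' : ↥(unitaryGroupOfForm (galAdicCompletionMap (L := L) (IsCMField.complexConj L) hw) (placeForm H w.1)) ⧸
          (glInt N (w.1.adicCompletion L)).subgroupOf (unitaryGroupOfForm (galAdicCompletionMap (L := L) (IsCMField.complexConj L) hw) (placeForm H w.1)) |
        q' ∈ MulAction.fixedBy (↥(unitaryGroupOfForm (galAdicCompletionMap (L := L) (IsCMField.complexConj L) hw) (placeForm H w.1)) ⧸
          (glInt N (w.1.adicCompletion L)).subgroupOf (unitaryGroupOfForm (galAdicCompletionMap (L := L) (IsCMField.complexConj L) hw) (placeForm H w.1)))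
            (localNonsplitEquiv (IsCMField.complexConj L) H (IsCMField.complexConj_ne_one L) w hw t) ∧
          (redMat ((((q'.out)⁻¹ * localNonsplitEquiv (IsCMField.complexConj L) H (IsCMField.complexConj_ne_one L) w hw t * q'.out :
              ↥(unitaryGroupOfForm (galAdicCompletionMap (L := L) (IsCMField.complexConj L) hw) (placeForm H w.1))) : GL (Fin N) (w.1.adicCompletion L)) :
                Matrix (Fin N) (Fin N) (w.1.adicCompletion L)) - 1).rank = r}.ncard := by
  -- the `w`-component matrix of `g` IS the matrix of its image in the one-place model (★ `coe_coe_localNonsplitEquiv_apply`, `rfl`)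
  have hcoe : ∀ g : (cmDatum L N H).Local v,
      ((g.val : GL (Fin N) (LocalRing L v)).val.map (Pi.evalRingHom (fun w' : UnitaryGroup.PlacesOver L v => w'.1.adicCompletion L) w)) =
        ((((localNonsplitEquiv (IsCMField.complexConj L) H (IsCMField.complexConj_ne_one L) w hw).toMulEquiv g :
          ↥(unitaryGroupOfForm (galAdicCompletionMap (L := L) (IsCMField.complexConj L) hw) (placeForm H w.1))) :
            GL (Fin N) (w.1.adicCompletion L)) : Matrix (Fin N) (Fin N) (w.1.adicCompletion L)) := fun g => rfl
  have key := ncard_fixedBy_sep_congr (cmLocalIntegralLevel L N H v)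
    ((glInt N (w.1.adicCompletion L)).subgroupOf (unitaryGroupOfForm (galAdicCompletionMap (L := L) (IsCMField.complexConj L) hw) (placeForm H w.1)))
    (localNonsplitEquiv (IsCMField.complexConj L) H (IsCMField.complexConj_ne_one L) w hw).toMulEquiv
    (fun g => by rw [Subgroup.mem_subgroupOf]; exact mem_localIntegralLevel_iff_of_smul_eq (IsCMField.complexConj L) N H (IsCMField.complexConj_ne_one L) w hw g)
    t (fun k => (redMat (((k.val : GL (Fin N) (LocalRing L v)).val.map (Pi.evalRingHom (fun w' : UnitaryGroup.PlacesOver L v => w'.1.adicCompletion L) w))) - 1).rank = r)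
    (fun u => (redMat (((u : ↥(unitaryGroupOfForm (galAdicCompletionMap (L := L) (IsCMField.complexConj L) hw) (placeForm H w.1))) :
      GL (Fin N) (w.1.adicCompletion L)) : Matrix (Fin N) (Fin N) (w.1.adicCompletion L)) - 1).rank = r)
    (fun k => iff_of_eq (congrArg (fun M : Matrix (Fin N) (Fin N) (w.1.adicCompletion L) => (redMat M - 1).rank = r) (hcoe k)))
    (fun k' hk' y hy => rank_redMat_coe_conj_sub_one_eq_iff _ (Subgroup.mem_subgroupOf.1 hk') (Subgroup.mem_subgroupOf.1 hy) r)
  exact key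

include hw in
/-- **THE REGULAR-UNIPOTENT STRATUM `n_{N−1}(t)` AS A LATTICE COUNT ON THE ONE-PLACE MODEL**: for `t` DEEP at `w`,
`#{q ∈ Fix_t(U(H)(L⁺_v) ⧸ U(H)(𝒪_v)) : rank(red((q.out⁻¹ t q.out)_w) − 1) = N − 1} = #{Λ = Λ(u), u ∈ U(σ_w, H_w)(L_w) : t_w Λ = Λ ∧ ∃ w′, Λ = ⊕_{j<N} 𝒪_w·t_w^j w′}` —
the `t_w`-stable lattices in the `U(σ_w, H_w)`-orbit of `𝒪_wᴺ` (the self-dual ones at a hyperspecial place, ★ `exists_mem_unitary_span_eq_iff_selfDual_of_nonsplit`) that are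
free of rank one over `𝒪_w[t_w]` = DESIGN v1 §2 O8a's input set (§3 transport ∘ ★ `ncard_fixedBy_unitary_rank_eq_ncard_free`).
[cite: Kottwitz1986, §3] [cite: Rogawski1990, §4.9 Prop. 4.9.1 (b) p. 55] [cite: PlatonovRapinchuk1994, §5.1] -/
theorem ncard_fixedBy_rankStratum_eq_ncard_free_of_deep (hJw : IsUnit (placeForm H w.1)) (t : (cmDatum L N H).Local v)
    (ht : ∀ m : ℕ, valuation (w.1.adicCompletion L)
      (((((t.val : GL (Fin N) (LocalRing L v)).val.map (Pi.evalRingHom (fun w' : UnitaryGroup.PlacesOver L v => w'.1.adicCompletion L) w))).charpoly -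
        (Polynomial.X - 1) ^ N).coeff m) < 1) :
    {q : (cmDatum L N H).Local v ⧸ cmLocalIntegralLevel L N H v |
        q ∈ MulAction.fixedBy ((cmDatum L N H).Local v ⧸ cmLocalIntegralLevel L N H v) t ∧
          (redMat ((((q.out⁻¹ * t * q.out : (cmDatum L N H).Local v)).val : GL (Fin N) (LocalRing L v)).val.map
            (Pi.evalRingHom (fun w' : UnitaryGroup.PlacesOver L v => w'.1.adicCompletion L) w)) - 1).rank = N - 1}.ncard =
      {Λ : Submodule 𝒪[w.1.adicCompletion L] (Fin N → w.1.adicCompletion L) |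
        (∃ u ∈ unitaryGroupOfForm (galAdicCompletionMap (L := L) (IsCMField.complexConj L) hw) (placeForm H w.1),
            Λ = Submodule.span 𝒪[w.1.adicCompletion L] (Set.range ((u : Matrix (Fin N) (Fin N) (w.1.adicCompletion L)))ᵀ)) ∧
          Λ.map ((Matrix.toLin' (((localNonsplitEquiv (IsCMField.complexConj L) H (IsCMField.complexConj_ne_one L) w hw t :
              ↥(unitaryGroupOfForm (galAdicCompletionMap (L := L) (IsCMField.complexConj L) hw) (placeForm H w.1))) :
                GL (Fin N) (w.1.adicCompletion L)) : Matrix (Fin N) (Fin N) (w.1.adicCompletion L))).restrictScalars 𝒪[w.1.adicCompletion L]) = Λ ∧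
            ∃ w' : Fin N → w.1.adicCompletion L, Λ = Submodule.span 𝒪[w.1.adicCompletion L] (Set.range fun j : Fin N =>
              ((((localNonsplitEquiv (IsCMField.complexConj L) H (IsCMField.complexConj_ne_one L) w hw t :
                ↥(unitaryGroupOfForm (galAdicCompletionMap (L := L) (IsCMField.complexConj L) hw) (placeForm H w.1))) :
                  GL (Fin N) (w.1.adicCompletion L)) : Matrix (Fin N) (Fin N) (w.1.adicCompletion L)) ^ (j : ℕ)) *ᵥ w')}.ncard := by
  rw [ncard_fixedBy_rankStratum_eq_ncard_localNonsplitEquiv L N H v w hw t (N - 1)]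
  exact ncard_fixedBy_unitary_rank_eq_ncard_free (galAdicCompletionMap (L := L) (IsCMField.complexConj L) hw) hJw.unit
    (localNonsplitEquiv (IsCMField.complexConj L) H (IsCMField.complexConj_ne_one L) w hw t) ht


/-! ## §4 The value of the orbital integral of a depth-zero piece -/

variable [MeasurableSpace ((cmDatum L N H).Local v)] [BorelSpace ((cmDatum L N H).Local v)]
  [∀ γ : (cmDatum L N H).Local v, MeasurableSpace ((cmDatum L N H).Local v ⧸ Subgroup.centralizer ({γ} : Set ((cmDatum L N H).Local v)))]
  [∀ γ : (cmDatum L N H).Local v, BorelSpace ((cmDatum L N H).Local v ⧸ Subgroup.centralizer ({γ} : Set ((cmDatum L N H).Local v)))]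
  (ν : Measure ((cmDatum L N H).Local v)) [IsHaarMeasure ν] [ν.IsMulRightInvariant]

include hw in
/-- **THE ORBITAL INTEGRAL OF A DEPTH-ZERO PIECE AT A DEEP REGULAR ELLIPTIC CLASS** (O8b «the four values of `g`», one literal at a time): for `m` canonical for
`(IsRegularElt, ν)`, `t ∈ U(H)(L⁺_v)` regular with compact centraliser and DEEP at `w`, and a piece `g ∈ C_c^∞` supported in `K_v = U(H)(𝒪_v)`, `Ad K_v`-invariant and
constant `= c r` on the residually-unipotent Jordan stratum `r` of `K_v` (HEAD v2's `hc`):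
`classOrbitalIntegral m g ⟦t⟧ = ν(K_v) · Σ_{r<N} #{q ∈ Fix_t(G′_v⧸K_v) : rank(red((q.out⁻¹ t q.out)_w) − 1) = r} • c r`.
[cite: Rogawski1990, §4.9 p. 54, Prop. 4.9.1 (b) p. 55] [cite: Laumon1995, Lemma (5.3.2) p. 136] [cite: Kottwitz1986, §3] -/
theorem classOrbitalIntegral_eq_smul_sum_ncard_rankStrata_of_deep (hN : 0 < N) (hH : (H.map (cmConjRingHom L))ᵀ = H) (hdet : H.det ≠ 0)
    {m : OrbitalMeasureFamily ((cmDatum L N H).Local v)} (hm : m.IsCanonical (fun γ => IsRegularElt (γ.val : GL (Fin N) (LocalRing L v))) ν)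
    (t : (cmDatum L N H).Local v) (hreg : IsRegularElt (t.val : GL (Fin N) (LocalRing L v)))
    [CompactSpace (Subgroup.centralizer ({t} : Set ((cmDatum L N H).Local v)))]
    (ht : ∀ m : ℕ, valuation (w.1.adicCompletion L)
      (((((t.val : GL (Fin N) (LocalRing L v)).val.map (Pi.evalRingHom (fun w' : UnitaryGroup.PlacesOver L v => w'.1.adicCompletion L) w))).charpoly -
        (Polynomial.X - 1) ^ N).coeff m) < 1)
    (g : (cmDatum L N H).Local v → ℂ) (hg : Literature.NumberTheory.Rogawski1990.IsLocSmooth g) (hgK : tsupport g ⊆ (cmLocalIntegralLevel L N H v : Set ((cmDatum L N H).Local v)))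
    (hgAd : ∀ u ∈ cmLocalIntegralLevel L N H v, ∀ x, g (u * x * u⁻¹) = g x)
    (c : ℕ → ℂ)
    (hc : ∀ k ∈ cmLocalIntegralLevel L N H v,
      (redMat (((k.val : GL (Fin N) (LocalRing L v)).val.map (Pi.evalRingHom (fun w' : UnitaryGroup.PlacesOver L v => w'.1.adicCompletion L) w))) - 1) ^ N = 0 →
      g k = c (redMat (((k.val : GL (Fin N) (LocalRing L v)).val.map (Pi.evalRingHom (fun w' : UnitaryGroup.PlacesOver L v => w'.1.adicCompletion L) w))) - 1).rank) :
    classOrbitalIntegral m g (ConjClasses.mk t) =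
      ν.real (cmLocalIntegralLevel L N H v : Set ((cmDatum L N H).Local v)) •
        ∑ r ∈ Finset.range N, ({q : (cmDatum L N H).Local v ⧸ cmLocalIntegralLevel L N H v |
            q ∈ MulAction.fixedBy ((cmDatum L N H).Local v ⧸ cmLocalIntegralLevel L N H v) t ∧
              (redMat ((((q.out⁻¹ * t * q.out : (cmDatum L N H).Local v)).val : GL (Fin N) (LocalRing L v)).val.map
                (Pi.evalRingHom (fun w' : UnitaryGroup.PlacesOver L v => w'.1.adicCompletion L) w)) - 1).rank = r}.ncard) • c r := by
  refine classOrbitalIntegral_eq_smul_sum_ncard_strata (P := fun γ : (cmDatum L N H).Local v => IsRegularElt (γ.val : GL (Fin N) (LocalRing L v)))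
    (fun g' x hg' => isRegularElt_val_conj L N H v g' x hg') hm hreg (cmLocalIntegralLevel L N H v)
    (isCompact_isOpen_cmLocalIntegralLevel L N H v).2 (isCompact_isOpen_cmLocalIntegralLevel L N H v).1
    (isClosed_conjClass_local_of_isRegularElt L N H v hH hdet t hreg) g hg.1.continuous
    ((subset_tsupport g).trans hgK) hgAd
    {k | (redMat (((k.val : GL (Fin N) (LocalRing L v)).val.map (Pi.evalRingHom (fun w' : UnitaryGroup.PlacesOver L v => w'.1.adicCompletion L) w))) - 1) ^ N = 0}
    (fun k => (redMat (((k.val : GL (Fin N) (LocalRing L v)).val.map (Pi.evalRingHom (fun w' : UnitaryGroup.PlacesOver L v => w'.1.adicCompletion L) w))) - 1).rank) c N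
    (fun k hk hkU => hc k hk hkU) (fun k _ hkU => ?_) (fun x hx => redMat_sub_one_pow_eq_zero_of_deep L N H v w hw t ht x hx)
  -- a nilpotent `N × N` matrix over the residue field has rank `< N`
  exact rank_lt_of_isNilpotent ⟨N, hkU⟩ hN

include hw in
/-- **O8d-1s SOCKET SHAPE (`N = 3`, `ℂ`-valued piece): `Φ(⟦t⟧, g) = ν(K_v) · (c₀ n₀(t) + c₁ n₁(t) + c₂ n₂(t))`** — ★ `classOrbitalIntegral_eq_smul_sum_ncard_rankStrata_of_deep`
with the `Finset.range 3` sum and the `•`s unfolded (`Complex.real_smul`, `nsmul_eq_mul`): exactly the `hΦ_i` hypothesis of F0P3b-p01's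
`finsum_finExplicitDelta_mul_classOrbitalIntegral_eq_of_split_of_strata` with `M = ν.real K_v`. [cite: Rogawski1990, §4.9 p. 54, Prop. 4.9.1 (b) p. 55] [cite: Kottwitz1986, §3] -/
theorem classOrbitalIntegral_eq_mul_strata_three_of_deep {H₃ : Matrix (Fin 3) (Fin 3) L}
    [MeasurableSpace ((cmDatum L 3 H₃).Local v)] [BorelSpace ((cmDatum L 3 H₃).Local v)]
    [∀ γ : (cmDatum L 3 H₃).Local v, MeasurableSpace ((cmDatum L 3 H₃).Local v ⧸ Subgroup.centralizer ({γ} : Set ((cmDatum L 3 H₃).Local v)))]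
    [∀ γ : (cmDatum L 3 H₃).Local v, BorelSpace ((cmDatum L 3 H₃).Local v ⧸ Subgroup.centralizer ({γ} : Set ((cmDatum L 3 H₃).Local v)))]
    (ν₃ : Measure ((cmDatum L 3 H₃).Local v)) [IsHaarMeasure ν₃] [ν₃.IsMulRightInvariant]
    (hH : (H₃.map (cmConjRingHom L))ᵀ = H₃) (hdet : H₃.det ≠ 0)
    {m : OrbitalMeasureFamily ((cmDatum L 3 H₃).Local v)} (hm : m.IsCanonical (fun γ => IsRegularElt (γ.val : GL (Fin 3) (LocalRing L v))) ν₃)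
    (t : (cmDatum L 3 H₃).Local v) (hreg : IsRegularElt (t.val : GL (Fin 3) (LocalRing L v)))
    [CompactSpace (Subgroup.centralizer ({t} : Set ((cmDatum L 3 H₃).Local v)))]
    (ht : ∀ m : ℕ, valuation (w.1.adicCompletion L)
      (((((t.val : GL (Fin 3) (LocalRing L v)).val.map (Pi.evalRingHom (fun w' : UnitaryGroup.PlacesOver L v => w'.1.adicCompletion L) w))).charpoly -
        (Polynomial.X - 1) ^ 3).coeff m) < 1)
    (g : (cmDatum L 3 H₃).Local v → ℂ) (hg : Literature.NumberTheory.Rogawski1990.IsLocSmooth g)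
    (hgK : tsupport g ⊆ (cmLocalIntegralLevel L 3 H₃ v : Set ((cmDatum L 3 H₃).Local v)))
    (hgAd : ∀ u ∈ cmLocalIntegralLevel L 3 H₃ v, ∀ x, g (u * x * u⁻¹) = g x)
    (c : ℕ → ℂ)
    (hc : ∀ k ∈ cmLocalIntegralLevel L 3 H₃ v,
      (redMat (((k.val : GL (Fin 3) (LocalRing L v)).val.map (Pi.evalRingHom (fun w' : UnitaryGroup.PlacesOver L v => w'.1.adicCompletion L) w))) - 1) ^ 3 = 0 →
      g k = c (redMat (((k.val : GL (Fin 3) (LocalRing L v)).val.map (Pi.evalRingHom (fun w' : UnitaryGroup.PlacesOver L v => w'.1.adicCompletion L) w))) - 1).rank) :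
    classOrbitalIntegral m g (ConjClasses.mk t) =
      (ν₃.real (cmLocalIntegralLevel L 3 H₃ v : Set ((cmDatum L 3 H₃).Local v)) : ℂ) *
        (c 0 * ({q : (cmDatum L 3 H₃).Local v ⧸ cmLocalIntegralLevel L 3 H₃ v |
            q ∈ MulAction.fixedBy ((cmDatum L 3 H₃).Local v ⧸ cmLocalIntegralLevel L 3 H₃ v) t ∧
              (redMat ((((q.out⁻¹ * t * q.out : (cmDatum L 3 H₃).Local v)).val : GL (Fin 3) (LocalRing L v)).val.map
                (Pi.evalRingHom (fun w' : UnitaryGroup.PlacesOver L v => w'.1.adicCompletion L) w)) - 1).rank = 0}.ncard : ℂ) +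
          c 1 * ({q : (cmDatum L 3 H₃).Local v ⧸ cmLocalIntegralLevel L 3 H₃ v |
            q ∈ MulAction.fixedBy ((cmDatum L 3 H₃).Local v ⧸ cmLocalIntegralLevel L 3 H₃ v) t ∧
              (redMat ((((q.out⁻¹ * t * q.out : (cmDatum L 3 H₃).Local v)).val : GL (Fin 3) (LocalRing L v)).val.map
                (Pi.evalRingHom (fun w' : UnitaryGroup.PlacesOver L v => w'.1.adicCompletion L) w)) - 1).rank = 1}.ncard : ℂ) +
          c 2 * ({q : (cmDatum L 3 H₃).Local v ⧸ cmLocalIntegralLevel L 3 H₃ v |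
            q ∈ MulAction.fixedBy ((cmDatum L 3 H₃).Local v ⧸ cmLocalIntegralLevel L 3 H₃ v) t ∧
              (redMat ((((q.out⁻¹ * t * q.out : (cmDatum L 3 H₃).Local v)).val : GL (Fin 3) (LocalRing L v)).val.map
                (Pi.evalRingHom (fun w' : UnitaryGroup.PlacesOver L v => w'.1.adicCompletion L) w)) - 1).rank = 2}.ncard : ℂ)) := by
  rw [classOrbitalIntegral_eq_smul_sum_ncard_rankStrata_of_deep L 3 H₃ v w hw ν₃ (by norm_num) hH hdet hm t hreg ht g hg hgK hgAd c hc]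
  exact real_smul_sum_range_three_nsmul _ (fun r => {q : (cmDatum L 3 H₃).Local v ⧸ cmLocalIntegralLevel L 3 H₃ v |
    q ∈ MulAction.fixedBy ((cmDatum L 3 H₃).Local v ⧸ cmLocalIntegralLevel L 3 H₃ v) t ∧
      (redMat ((((q.out⁻¹ * t * q.out : (cmDatum L 3 H₃).Local v)).val : GL (Fin 3) (LocalRing L v)).val.map
        (Pi.evalRingHom (fun w' : UnitaryGroup.PlacesOver L v => w'.1.adicCompletion L) w)) - 1).rank = r}.ncard) c

end CM

end Literature.NumberTheory.Automorphic

end
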